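import Summits.CriticalPhenomena.PercolationContinuityZ3.Theorems.PercNearOneGluingNoHeavyQuantLightSliceLowCrossBelowTypeI
import Summits.CriticalPhenomena.PercolationContinuityZ3.Theorems.PercNearOneGluingNoHeavyQuantLightSliceWidePrices
import Summits.CriticalPhenomena.PercolationContinuityZ3.Theorems.PercNearOneGluingNoHeavyQuantWideCellReal
import HarnessLib

/-!
# QUANT lane R8, T-DEC: **`LightSliceWide` IS A THEOREM AT EVERY FLOOR** — the wide residue of the light-slice core closed in the kernel,
# hence **`LightSliceCore`** (binder (II) of the R8 law level) and **`ConvClosedT`** UNCONDITIONALLY (census-2 g60)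

builds on p205010 (kernel theorem, internal audit signed; external expert review pending)

Support file (`--supports stmt-CriticalPhenomena-4575`), QUANT lane seat prim-quant-census-2 (gen 60), rung R8 of `…/quant/LADDER.md`.
Memo `run/shared/lean/prim/quant/prim-quant-census-2-g60/WIDE-G60.md`.  Theorems only, standard axioms, no sorries, no definitions.

* **`LawDec.lightSlice_decAtT_wide`** — floor `0 < x < 1`; side 1's light credit pair `{p, m}` at `T₁` (`2p < T₁ < p+m`, `m ≤ j`, `m ≤ M₁`,
  usage `< u`); side 2's admissible atom `(l, h; l′, h′)` at `T₂` (`AtomData`, `l < l′`, `h′ ≤ h`); the residue geometry of `LightSliceWide`: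
  `p + h′ ≤ j`, `m + l′ ≤ j`, tie `m + l′ ≤ p + h′`, top giant `j+1 ≤ m+h′`, the upper cross cell a MID `T₁+T₂ ≤ 2(m+l′)`, and the aspect
  `4(m − p) < h′ − l′`.  Then the light slice `lconv M₁ M₂ (TP[p, m; gateOf x T₁ j p m]) (atomLaw x T₂ j l h l′ h′)` is `DECAtT x (T₁+T₂) j (M₁+M₂)`.
  PROOF.  The eight-term law (`lightSlice_eq_terms`) and the all-mids price criterion `decAtT_of_prices_terms`; the prices are bounded by the
  PURE SPLIT (memo §3: each low priced only against the mids of its own piece, shared giants): piece C (`P2 → M2, PH`) by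
  `WideCell.pieceC`/`restC_le(_theta)`, piece E (`P1, M1 → PG, M1`) by `WideCell.pieceE_low/_mid`, assembled in `WideCell.main_g/_ml/_mm`
  according to whether `p + h` is a giant or a mid and `m + l` a conv-low or a mid.  Rates: `r`, `c = ρ_c`, `a < 1/4`, `ρ_e`, `w = ρ_e ε`
  (`ε = (h−l)/(h′−l′) > 1`), pairs `P2→PH` (`c + ra`), `P2→M2` (`(c+ra)/a`), `P1→PG` (`ρ_e(w+ra)/w`), `M1→PG` (`ρ_e(w+ra−2a)/(w−aρ_e)`),
  `P1→M1` (`(w+ra)/a`).  No certificate is used: the whole class is elementary (memo §4).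
* **`LawDec.lightSliceWide_holds : LightSliceWide`**, hence with `…LowCrossBelowTypeI`: **`lightSliceCore_holds : LightSliceCore`**,
  **`convClosedT_holds : ConvClosedT`**, and `Quant.farTreeRow_of_gatedConvEmptyFree : GatedConvEmptyFree → FarTreeRow`,
  `Quant.farTreeRow_of_gateMove : GateMove → FarTreeRow`.
STATE of the R8 law level after this file: binder (II) is CLOSED; `FarTreeRow ⟸ (III)` (`GatedConvEmptyFree ∨ GateMove`) alone.
EXACT EVIDENCE before the proof: arm-2 g32 `lightSliceWide_of_sharpFloor` (floors `1 ≤ x³+x²+3x`); the cell LP 0 / 26 000 on the relaxed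
six-variable region at all floors (memo §2).

[this work].  The gluing rows served [cite: KozmaNitzan2024, Conjecture 3 (p. 15)]; product measure [cite: Grimmett1999, §1.3 p. 10].
-/

noncomputable section

namespace Summit.CriticalPhenomena.PercolationContinuityZ3.Theorems

namespace Quant

open Finset

/-- the two-point law `{lo, hi; g}` (as in `…QuantLawDEC`) -/
local notation3 "TP[" lo ", " hi ", " g ", " h "]" =>
  (g : ℝ) * (if (h : ℕ) = (hi : ℕ) then (1 : ℝ) else 0) + (1 - (g : ℝ)) * (if (h : ℕ) = (lo : ℕ) then (1 : ℝ) else 0)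

namespace LawDec

/-- light usage `U_ℓ(ρ)` (class-level copy of the notation) -/
local notation3 "UL'[" x ", " ρ "]" => ((x : ℝ) ^ 2 + (1 - x) * ρ) / ((1 - x) * (1 + x - ρ))

set_option maxHeartbeats 4000000 in
/-- the four cell inequalities `WideCell.main_*` in the shape of the price form `lightSlice_decAtT_wide_of_prices` (the `if`s decide
whether `p + h` is a mid and whether `m + l` is a conv-low). [this work] -/
theorem wide_dual (x r c a γ ρe w mE mC c₁ c₂ ρS ρN UH UM US UN U1 αP1 αP2 αM1 βH βM βG β1 : ℝ) (PGmid M1low cM cS c1 : Prop)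
    [Decidable PGmid] [Decidable M1low] [Decidable cM] [Decidable cS] [Decidable c1]
    (hγ : γ = x ^ 2 + (1 - x) * r) (hx0 : 0 < x) (hx1 : x < 1) (hr0 : 0 ≤ r) (hrx : r < x) (hc0 : 0 ≤ c) (hcx : c < x)
    (ha0 : 0 < a) (ha4 : 4 * a ≤ 1) (hρP1 : c + r * a < 1) (hρe : x < ρe) (hρe1 : ρe < 1) (hwe : ρe < w)
    (hM1iff : M1low ↔ 2 * a < w + r * a) (hmE : 0 ≤ mE) (hmC : 0 < mC) (hc₁ : c₁ = ρe / (1 - ρe)) (hc₂ : c₂ = UL'[x, c])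
    (hbal : mE * (c₁ - x / (1 - x)) = mC * (x / (1 - x) - c₂))
    (hUHl : c + r * a ≤ x → UH = UL'[x, c + r * a]) (hUHh : x ≤ c + r * a → UH = (c + r * a) / (1 - (c + r * a)))
    (hcM : cM ↔ c + r * a < a) (hUMl : (c + r * a) / a ≤ x → c + r * a < a → UM = UL'[x, (c + r * a) / a])
    (hUMh : x ≤ (c + r * a) / a → c + r * a < a → UM = ((c + r * a) / a) / (1 - (c + r * a) / a))
    (hρS : ρS = ρe * (w + r * a) / w) (hcS : cS ↔ ρS < 1) (hUS : PGmid → ρS < 1 → US = ρS / (1 - ρS))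
    (hρN : ρN = ρe * (w + r * a - 2 * a) / (w - a * ρe)) (hUNl : PGmid → M1low → ρN ≤ x → UN = UL'[x, ρN])
    (hUNh : PGmid → M1low → x ≤ ρN → UN = ρN / (1 - ρN))
    (hc1 : c1 ↔ w + r * a < a) (hU1 : w + r * a < a → U1 = ((w + r * a) / a) / (1 - (w + r * a) / a))
    (hβH : 0 ≤ βH) (hβM : 0 ≤ βM) (hβG : 0 ≤ βG) (hβ1 : 0 ≤ β1) (hαP1 : αP1 ≤ 1) (hαP2 : αP2 ≤ 1) (hαM1 : M1low → αM1 ≤ 1)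
    (hαH : αP2 ≤ UH * βH) (hαM : cM → αP2 ≤ UM * βM) (hαS : PGmid → cS → αP1 ≤ US * βG)
    (hαN : PGmid → M1low → αM1 ≤ UN * βG) (hα1 : ¬ M1low → c1 → αP1 ≤ U1 * β1) :
    (1 - γ) * mE * αP1 + (1 - γ) * mC * αP2 + (if M1low then γ * mE * αM1 else 0)
      ≤ βH * ((1 - γ) * mC * c₂) + βM * (γ * mC) + (if PGmid then βG * ((1 - γ) * mE * c₁) else 0)
        + (if M1low then 0 else β1 * (γ * mE))
        + ((1 - x) / x) * (γ * mC * c₂ + γ * mE * c₁ + (if PGmid then 0 else (1 - γ) * mE * c₁)) := by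
  have hγ0 : 0 ≤ γ := by rw [hγ]; nlinarith
  have hγE0 : 0 ≤ γ * mE := mul_nonneg hγ0 hmE
  by_cases hPG : PGmid
  · rw [if_pos hPG, if_pos hPG]
    by_cases hM1 : M1low
    · rw [if_pos hM1, if_pos hM1]
      have key := WideCell.main_ml x r c a γ ρe w (c + r * a) mE mC c₁ c₂ ρS ρN UH UM US UN βH βM βG αP1 αP2 αM1 cM cS
        hγ hx0 hx1 hr0 hrx hc0 hcx ha0 ha4 rfl hρP1 hρe hρe1 hwe (hM1iff.1 hM1) hmE hmC hc₁ hc₂ hbal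
        hUHl hUHh hcM hUMl hUMh hρS hcS (hUS hPG) hρN (hUNl hPG hM1) (hUNh hPG hM1)
        hβH hβM hβG hαP1 hαP2 (hαM1 hM1) hαH hαM (hαS hPG) (hαN hPG hM1)
      linarith [key]
    · rw [if_neg hM1, if_neg hM1]
      have key := WideCell.main_mm x r c a γ ρe w (c + r * a) mE mC c₁ c₂ ρS UH UM US U1 βH βM βG β1 αP1 αP2 cM cS c1
        hγ hx0 hx1 hr0 hrx hc0 hcx ha0 ha4 rfl hρP1 hρe hρe1 hwe hmE hmC hc₁ hc₂ hbal
        hUHl hUHh hcM hUMl hUMh hρS hcS (hUS hPG) hc1 hU1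
        hβH hβM hβG hβ1 hαP1 hαP2 hαH hαM (hαS hPG) (hα1 hM1)
      linarith [key]
  · rw [if_neg hPG, if_neg hPG]
    by_cases hM1 : M1low
    · rw [if_pos hM1, if_pos hM1]
      have key := WideCell.main_g x r c a γ ρe (c + r * a) mE mC c₁ c₂ UH UM βH βM αP1 αP2 αM1
        ((1 - γ) * mE * αP1 + γ * mE * αM1) cM
        hγ hx0 hx1 hr0 hrx hc0 hcx ha0 ha4 rfl hρP1 hρe hρe1 hmE hmC hc₂ hbal
        hUHl hUHh hcM hUMl hUMh hβH hβM hαP1 hαP2 (hαM1 hM1) hαH hαM le_rfl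
      linarith [key]
    · rw [if_neg hM1, if_neg hM1]
      have key := WideCell.main_g x r c a γ ρe (c + r * a) mE mC c₁ c₂ UH UM βH βM αP1 αP2 0 ((1 - γ) * mE * αP1) cM
        hγ hx0 hx1 hr0 hrx hc0 hcx ha0 ha4 rfl hρP1 hρe hρe1 hmE hmC hc₂ hbal
        hUHl hUHh hcM hUMl hUMh hβH hβM hαP1 hαP2 zero_le_one hαH hαM (by rw [mul_zero, add_zero])
      have hb4 : 0 ≤ β1 * (γ * mE) := mul_nonneg hβ1 hγE0
      linarith [key]

set_option maxHeartbeats 4000000 in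
/-- **THE WIDE RESIDUE CLASS IS DEC (every floor).**  See the module docstring. [this work] -/
theorem lightSlice_decAtT_wide (x T₁ T₂ : ℝ) (M₁ M₂ j p m l h l' h' : ℕ) (hx0 : 0 < x) (hx1 : x < 1)
    (hlow₁ : 2 * (p : ℝ) < T₁) (hmj : m ≤ j) (hmM : m ≤ M₁) (hc₁ : T₁ < (p : ℝ) + m) (hlight₁ : usage x T₁ j p m < x / (1 - x))
    (hd₂ : AtomData x T₂ j M₂ l h l' h') (hll' : l < l') (hh'h : h' ≤ h)
    (hdeep₁ : p + h' ≤ j) (hdeep₂ : m + l' ≤ j) (htie : m + l' ≤ p + h') (htop : j + 1 ≤ m + h')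
    (hmid : T₁ + T₂ ≤ 2 * ((m : ℝ) + l')) (hwide : 4 * ((m : ℝ) - p) < (h' : ℝ) - l') :
    DECAtT x (T₁ + T₂) j (M₁ + M₂) (lconv M₁ M₂ (fun b => TP[p, m, gateOf x T₁ j p m, b]) (atomLaw x T₂ j l h l' h')) := by
  classical
  obtain ⟨hlh, hl'h'⟩ := hd₂.lt_of
  obtain ⟨-, a2, a3, a4, a5, -, b2, b3, b4, b5, -, c2, c1⟩ := hd₂
  have hpm' : (p : ℝ) < m := by linarith
  have hpm : p < m := by exact_mod_cast hpm'
  have hlh'' : (l' : ℝ) < h' := by exact_mod_cast hl'h'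
  have hlh' : (l : ℝ) < h := by exact_mod_cast hlh
  have hll'r : (l : ℝ) < l' := by exact_mod_cast hll'
  have hh'hr : (h' : ℝ) ≤ h := by exact_mod_cast hh'h
  have h1x : 0 < 1 - x := by linarith
  have hu0 : 0 < x / (1 - x) := div_pos hx0 h1x
  obtain ⟨hγx2, hγ1⟩ := gateOf_bounds x T₁ j p m hx0 hx1 hlow₁ hmj hc₁
  have hγx : gateOf x T₁ j p m < x := gate_lt_of_usage_lt x T₁ j p m hx1 hγ1 hlight₁
  have hγ0 : 0 ≤ gateOf x T₁ j p m := by have := sq_nonneg x; linarith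
  have hc₂0 : 0 ≤ usage x T₂ j l' h' := (usage_pos_of_compat x T₂ j l' h' hx0 hx1 b2 hl'h' (Or.inr b5)).le
  -- ### spans and rates (`B′ = h′ − l′`)
  have hA0 : (0 : ℝ) < (m : ℝ) - p := by linarith
  have hB0 : (0 : ℝ) < (h' : ℝ) - l' := by linarith
  have hE0 : (0 : ℝ) < (h : ℝ) - l := by linarith
  obtain ⟨r, hr⟩ : ∃ r : ℝ, r = (T₁ - 2 * (p : ℝ)) / ((m : ℝ) - p) := ⟨_, rfl⟩
  obtain ⟨c, hc⟩ : ∃ c : ℝ, c = (T₂ - 2 * (l' : ℝ)) / ((h' : ℝ) - l') := ⟨_, rfl⟩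
  obtain ⟨a, ha⟩ : ∃ a : ℝ, a = ((m : ℝ) - p) / ((h' : ℝ) - l') := ⟨_, rfl⟩
  obtain ⟨ρe, hρe⟩ : ∃ ρe : ℝ, ρe = (T₂ - 2 * (l : ℝ)) / ((h : ℝ) - l) := ⟨_, rfl⟩
  obtain ⟨w, hw⟩ : ∃ w : ℝ, w = (T₂ - 2 * (l : ℝ)) / ((h' : ℝ) - l') := ⟨_, rfl⟩
  have hrA : r * ((m : ℝ) - p) = T₁ - 2 * (p : ℝ) := by rw [hr]; field_simp
  have hcB : c * ((h' : ℝ) - l') = T₂ - 2 * (l' : ℝ) := by rw [hc]; field_simp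
  have haB : a * ((h' : ℝ) - l') = (m : ℝ) - p := by rw [ha]; field_simp
  have hρeE : ρe * ((h : ℝ) - l) = T₂ - 2 * (l : ℝ) := by rw [hρe]; field_simp
  have hwB : w * ((h' : ℝ) - l') = T₂ - 2 * (l : ℝ) := by rw [hw]; field_simp
  have hr0 : 0 ≤ r := by rw [hr]; exact div_nonneg (by linarith) hA0.le
  have hrx : r < x := rate_lt_of_usage_lt x T₁ j p m r hx1 hmj hA0 hrA hγ1 hlight₁
  obtain ⟨-, hg2'⟩ := gateOf_bounds x T₂ j l' h' hx0 hx1 b2 b3 b5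
  have hcx : c < x := rate_lt_of_usage_lt x T₂ j l' h' c hx1 b3 hB0 hcB hg2' c2
  have hc0 : 0 ≤ c := by rw [hc]; exact div_nonneg (by linarith) hB0.le
  have ha0 : 0 < a := by rw [ha]; exact div_pos hA0 hB0
  have ha4 : 4 * a ≤ 1 := by
    rw [ha]; rw [show 4 * (((m : ℝ) - p) / ((h' : ℝ) - l')) = (4 * ((m : ℝ) - p)) / ((h' : ℝ) - l') by ring, div_le_one hB0]
    linarith
  have hraB : r * (a * ((h' : ℝ) - l')) = r * ((m : ℝ) - p) := by rw [haB]
  -- the expensive rate: heavy and compatible, and `w = ρe ε > ρe`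
  have hρe1 : ρe < 1 := by
    have : ρe * ((h : ℝ) - l) < 1 * ((h : ℝ) - l) := by rw [hρeE]; linarith
    exact lt_of_mul_lt_mul_right this hE0.le
  have hρex : x < ρe := by
    by_contra hle
    push Not at hle
    obtain ⟨-, hg1e⟩ := gateOf_bounds x T₂ j l h hx0 hx1 a2 a3 a5
    have hUl := usage_eq_Ul x T₂ j l h ρe hx0 hx1 a3 a2 a5 hρeE hle
    have : usage x T₂ j l h ≤ x / (1 - x) := by rw [hUl]; exact CrossGiantCell.Ul_le_u x ρe hx0 hx1 hle
    linarith
  have hρe0 : 0 < ρe := by linarith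
  have hwe : ρe < w := by
    -- `w B′ = ρe E` with `E > B′`
    have e : w * ((h' : ℝ) - l') = ρe * ((h : ℝ) - l) := by rw [hwB, hρeE]
    by_contra hle
    push Not at hle
    have h1 : w * ((h' : ℝ) - l') ≤ ρe * ((h' : ℝ) - l') := mul_le_mul_of_nonneg_right hle hB0.le
    have h2 : ρe * ((h' : ℝ) - l') < ρe * ((h : ℝ) - l) := mul_lt_mul_of_pos_left (by linarith) hρe0
    linarith
  have hw0 : 0 < w := by linarith
  -- the mid `m + l′`: `ρP := c + ra ≤ 2a`, hence `ρP < 1`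
  have hPB : (c + r * a) * ((h' : ℝ) - l') = (T₁ + T₂) - 2 * ((p : ℝ) + l') := by linarith [hraB, hrA, hcB]
  have hρP2 : c + r * a ≤ 2 * a := by
    have : (c + r * a) * ((h' : ℝ) - l') ≤ (2 * a) * ((h' : ℝ) - l') := by
      rw [hPB]; linarith [haB]
    exact le_of_mul_le_mul_right this hB0
  have hρP1 : c + r * a < 1 := by linarith
  have hρP0 : 0 ≤ c + r * a := by have := mul_nonneg hr0 ha0.le; linarith
  -- ### the gate and the atom's rates in closed form
  have hγ : gateOf x T₁ j p m = x ^ 2 + (1 - x) * r := by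
    rw [gateOf_of_le x T₁ j p m hmj, pairGate_eq_light x T₁ p m hx0.le (by rw [← hr]; exact hrx.le), ← hr]
  have hc₂v : usage x T₂ j l' h' = UL'[x, c] := usage_eq_Ul x T₂ j l' h' c hx0 hx1 b3 b2 b5 hcB hcx.le
  have hc₁v : usage x T₂ j l h = ρe / (1 - ρe) := usage_eq_Uh x T₂ j l h ρe hx0 hx1 a3 a2 a5 hρeE hρex.le
  -- ### piece C pairs: P2 = p + l' into PH = p + h' (rate `c + ra`) and into M2 = m + l' (rate `(c + ra)/a`)
  have hPspan : (c + r * a) * ((((p + h' : ℕ) : ℝ)) - ((p + l' : ℕ) : ℝ)) = (T₁ + T₂) - 2 * (((p + l' : ℕ) : ℝ)) := by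
    push_cast
    have e : ((p : ℝ) + h' - ((p : ℝ) + l')) = (h' : ℝ) - l' := by ring
    rw [e, hPB]
  have hlowP : 2 * (((p + l' : ℕ) : ℝ)) < T₁ + T₂ := by push_cast; linarith
  have hcompP : T₁ + T₂ < ((p + l' : ℕ) : ℝ) + ((p + h' : ℕ) : ℝ) := by
    have h1 : (c + r * a) * ((h' : ℝ) - l') < 1 * ((h' : ℝ) - l') := mul_lt_mul_of_pos_right hρP1 hB0
    rw [hPB] at h1; push_cast; linarith
  have hUHl : c + r * a ≤ x → usage x (T₁ + T₂) j (p + l') (p + h') = UL'[x, c + r * a] := fun hPx =>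
    usage_eq_Ul x (T₁ + T₂) j (p + l') (p + h') (c + r * a) hx0 hx1 hdeep₁ hlowP hcompP hPspan hPx
  have hUHh : x ≤ c + r * a → usage x (T₁ + T₂) j (p + l') (p + h') = (c + r * a) / (1 - (c + r * a)) := fun hPx =>
    usage_eq_Uh x (T₁ + T₂) j (p + l') (p + h') (c + r * a) hx0 hx1 hdeep₁ hlowP hcompP hPspan hPx
  have hMspan : ((c + r * a) / a) * ((((m + l' : ℕ) : ℝ)) - ((p + l' : ℕ) : ℝ)) = (T₁ + T₂) - 2 * (((p + l' : ℕ) : ℝ)) := by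
    push_cast
    have e : ((m : ℝ) + l' - ((p : ℝ) + l')) = a * ((h' : ℝ) - l') := by rw [haB]; ring
    rw [e, ← hPB]; field_simp
  have hcM : (T₁ + T₂ < ((p : ℝ) + l') + ((m : ℝ) + l')) ↔ c + r * a < a := by
    constructor
    · intro hlt
      have : (c + r * a) * ((h' : ℝ) - l') < a * ((h' : ℝ) - l') := by rw [hPB, haB]; linarith
      exact lt_of_mul_lt_mul_right this hB0.le
    · intro hlt
      have := mul_lt_mul_of_pos_right hlt hB0
      rw [hPB, haB] at this; linarith
  have hcompM : c + r * a < a → T₁ + T₂ < ((p + l' : ℕ) : ℝ) + ((m + l' : ℕ) : ℝ) := fun hlt => by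
    push_cast; exact hcM.2 hlt
  have hUMl : (c + r * a) / a ≤ x → c + r * a < a → usage x (T₁ + T₂) j (p + l') (m + l') = UL'[x, (c + r * a) / a] :=
    fun hσ hlt => usage_eq_Ul x (T₁ + T₂) j (p + l') (m + l') ((c + r * a) / a) hx0 hx1 hdeep₂ hlowP (hcompM hlt) hMspan hσ
  have hUMh : x ≤ (c + r * a) / a → c + r * a < a →
      usage x (T₁ + T₂) j (p + l') (m + l') = ((c + r * a) / a) / (1 - (c + r * a) / a) :=
    fun hσ hlt => usage_eq_Uh x (T₁ + T₂) j (p + l') (m + l') ((c + r * a) / a) hx0 hx1 hdeep₂ hlowP (hcompM hlt) hMspan hσ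
  -- ### piece E pairs: P1 = p + l, M1 = m + l into PG = p + h and P1 into M1
  have hra0 : 0 ≤ r * a := mul_nonneg hr0 ha0.le
  have hSB : (w + r * a) * ((h' : ℝ) - l') = (T₁ + T₂) - 2 * ((p : ℝ) + l) := by linarith [hraB, hrA, hwB]
  have hEw : ρe * ((h : ℝ) - l) = w * ((h' : ℝ) - l') := by rw [hρeE, hwB]
  obtain ⟨ρS, hρS⟩ : ∃ ρS : ℝ, ρS = ρe * (w + r * a) / w := ⟨_, rfl⟩
  have hSE : ρS * ((h : ℝ) - l) = (T₁ + T₂) - 2 * ((p : ℝ) + l) := by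
    rw [hρS, ← hSB]
    have : ρe * (w + r * a) / w * ((h : ℝ) - l) = (w + r * a) / w * (ρe * ((h : ℝ) - l)) := by ring
    rw [this, hEw]; field_simp
  have hSspan : ρS * ((((p + h : ℕ) : ℝ)) - ((p + l : ℕ) : ℝ)) = (T₁ + T₂) - 2 * (((p + l : ℕ) : ℝ)) := by
    push_cast
    have e : ((p : ℝ) + h - ((p : ℝ) + l)) = (h : ℝ) - l := by ring
    rw [e, hSE]
  have hρSe : ρe ≤ ρS := by
    rw [hρS, le_div_iff₀ hw0]
    have := mul_nonneg hρe0.le hra0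
    linarith
  have hcS : (T₁ + T₂ < ((p : ℝ) + l) + ((p : ℝ) + h)) ↔ ρS < 1 := by
    constructor
    · intro hlt
      have : ρS * ((h : ℝ) - l) < 1 * ((h : ℝ) - l) := by rw [hSE]; linarith
      exact lt_of_mul_lt_mul_right this hE0.le
    · intro hS1
      have : ρS * ((h : ℝ) - l) < 1 * ((h : ℝ) - l) := mul_lt_mul_of_pos_right hS1 hE0
      rw [hSE] at this; linarith
  have hlowS : 2 * (((p + l : ℕ) : ℝ)) < T₁ + T₂ := by push_cast; linarith
  have hUS : p + h ≤ j → ρS < 1 → usage x (T₁ + T₂) j (p + l) (p + h) = ρS / (1 - ρS) := by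
    intro hPG hS1
    have hc' : T₁ + T₂ < ((p + l : ℕ) : ℝ) + ((p + h : ℕ) : ℝ) := by push_cast; exact hcS.2 hS1
    exact usage_eq_Uh x (T₁ + T₂) j (p + l) (p + h) ρS hx0 hx1 hPG hlowS hc' hSspan (by linarith)
  -- M1 → PG
  have hwa : 0 < w - a * ρe := by
    have : a * ρe < 1 * ρe := mul_lt_mul_of_pos_right (by linarith) hρe0
    linarith
  have hwa' : w - ρe * a ≠ 0 := by
    have : (0:ℝ) < w - ρe * a := by linarith
    exact this.ne'
  obtain ⟨ρN, hρN⟩ : ∃ ρN : ℝ, ρN = ρe * (w + r * a - 2 * a) / (w - a * ρe) := ⟨_, rfl⟩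
  have hspanN : ρe * ((((p + h : ℕ) : ℝ)) - ((m + l : ℕ) : ℝ)) = (w - a * ρe) * ((h' : ℝ) - l') := by
    push_cast
    have : ρe * ((p : ℝ) + h - ((m : ℝ) + l)) = ρe * ((h : ℝ) - l) - ρe * ((m : ℝ) - p) := by ring
    rw [this, hEw, ← haB]; ring
  have hNB : (w + r * a - 2 * a) * ((h' : ℝ) - l') = (T₁ + T₂) - 2 * ((m : ℝ) + l) := by linarith [hSB, haB]
  have hNspan : ρN * ((((p + h : ℕ) : ℝ)) - ((m + l : ℕ) : ℝ)) = (T₁ + T₂) - 2 * (((m + l : ℕ) : ℝ)) := by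
    have hd : (((p + h : ℕ) : ℝ)) - ((m + l : ℕ) : ℝ) = (w - a * ρe) * ((h' : ℝ) - l') / ρe := by
      rw [← hspanN]; field_simp
    rw [hd, hρN]
    have : ρe * (w + r * a - 2 * a) / (w - a * ρe) * ((w - a * ρe) * ((h' : ℝ) - l') / ρe)
        = (w + r * a - 2 * a) * ((h' : ℝ) - l') := by field_simp
    rw [this, hNB]; push_cast; ring
  have hρNe : ρN ≤ ρe := by
    rw [hρN, div_le_iff₀ hwa]
    have : 0 ≤ ρe * a * (2 - ρe - r) := mul_nonneg (mul_nonneg hρe0.le ha0.le) (by linarith)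
    linarith
  have hcompN : T₁ + T₂ < ((m + l : ℕ) : ℝ) + ((p + h : ℕ) : ℝ) := by
    -- `(m+l)+(p+h) − T = span − (T − 2(m+l))` with `ρe·span = (w − aρe)B′`, `T − 2(m+l) = (w+ra−2a)B′`
    have hd0 : 0 < (((p + h : ℕ) : ℝ)) - ((m + l : ℕ) : ℝ) := by push_cast; linarith
    have h1 : ρN * ((((p + h : ℕ) : ℝ)) - ((m + l : ℕ) : ℝ)) < 1 * ((((p + h : ℕ) : ℝ)) - ((m + l : ℕ) : ℝ)) :=
      mul_lt_mul_of_pos_right (by linarith) hd0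
    rw [hNspan] at h1; push_cast at h1 ⊢; linarith
  have hM1iff : (2 * ((m : ℝ) + l) < T₁ + T₂) ↔ 2 * a < w + r * a := by
    constructor
    · intro hlt
      have : 0 * ((h' : ℝ) - l') < (w + r * a - 2 * a) * ((h' : ℝ) - l') := by rw [zero_mul, hNB]; linarith
      have := lt_of_mul_lt_mul_right this hB0.le
      linarith
    · intro hlt
      have h2 : 0 < (w + r * a - 2 * a) * ((h' : ℝ) - l') := mul_pos (by linarith) hB0
      rw [hNB] at h2; linarith
  have hUNl : p + h ≤ j → 2 * ((m : ℝ) + l) < T₁ + T₂ → ρN ≤ x → usage x (T₁ + T₂) j (m + l) (p + h) = UL'[x, ρN] := by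
    intro hPG hM1 hNx
    exact usage_eq_Ul x (T₁ + T₂) j (m + l) (p + h) ρN hx0 hx1 hPG (by push_cast; exact hM1) hcompN hNspan hNx
  have hUNh : p + h ≤ j → 2 * ((m : ℝ) + l) < T₁ + T₂ → x ≤ ρN → usage x (T₁ + T₂) j (m + l) (p + h) = ρN / (1 - ρN) := by
    intro hPG hM1 hNx
    exact usage_eq_Uh x (T₁ + T₂) j (m + l) (p + h) ρN hx0 hx1 hPG (by push_cast; exact hM1) hcompN hNspan hNx
  -- P1 → M1 (rate `(w + ra)/a`, heavy)
  have h1span : ((w + r * a) / a) * ((((m + l : ℕ) : ℝ)) - ((p + l : ℕ) : ℝ)) = (T₁ + T₂) - 2 * (((p + l : ℕ) : ℝ)) := by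
    push_cast
    have e : ((m : ℝ) + l - ((p : ℝ) + l)) = a * ((h' : ℝ) - l') := by rw [haB]; ring
    rw [e, ← hSB]; field_simp
  have hc1 : (T₁ + T₂ < ((p : ℝ) + l) + ((m : ℝ) + l)) ↔ w + r * a < a := by
    constructor
    · intro hlt
      have : (w + r * a) * ((h' : ℝ) - l') < a * ((h' : ℝ) - l') := by rw [hSB, haB]; linarith
      exact lt_of_mul_lt_mul_right this hB0.le
    · intro hlt
      have := mul_lt_mul_of_pos_right hlt hB0
      rw [hSB, haB] at this; linarith
  have hml_j : m + l ≤ j := by omega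
  have hU1 : w + r * a < a → usage x (T₁ + T₂) j (p + l) (m + l) = ((w + r * a) / a) / (1 - (w + r * a) / a) := by
    intro hlt
    have hc' : T₁ + T₂ < ((p + l : ℕ) : ℝ) + ((m + l : ℕ) : ℝ) := by push_cast; exact hc1.2 hlt
    refine usage_eq_Uh x (T₁ + T₂) j (p + l) (m + l) ((w + r * a) / a) hx0 hx1 hml_j hlowS hc' h1span ?_
    rw [le_div_iff₀ ha0]
    have : x * a ≤ x * 1 := mul_le_mul_of_nonneg_left (by linarith) hx0.le
    linarith
  -- ### masses and the balance identity
  have hK : 0 < (1 - x) / (usage x T₂ j l h - usage x T₂ j l' h') := div_pos h1x (by linarith [c2.trans c1])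
  obtain ⟨mE, hmEdef⟩ : ∃ mE : ℝ, mE = (1 - x) / (usage x T₂ j l h - usage x T₂ j l' h') * (x / (1 - x) - usage x T₂ j l' h') := ⟨_, rfl⟩
  obtain ⟨mC, hmCdef⟩ : ∃ mC : ℝ, mC = (1 - x) / (usage x T₂ j l h - usage x T₂ j l' h') * (usage x T₂ j l h - x / (1 - x)) := ⟨_, rfl⟩
  have hmE : 0 ≤ mE := by rw [hmEdef]; exact mul_nonneg hK.le (by linarith [c2])
  have hmC : 0 < mC := by rw [hmCdef]; exact mul_pos hK (by linarith [c1])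
  have hbal : mE * (usage x T₂ j l h - x / (1 - x)) = mC * (x / (1 - x) - usage x T₂ j l' h') := by
    rw [hmEdef, hmCdef]; ring
  -- ### the price form and the four cell inequalities
  refine lightSlice_decAtT_wide_of_prices x (T₁ + T₂) T₂ (gateOf x T₁ j p m) M₁ M₂ j p m l h l' h' hx0 hx1 hγ0 hγ1.le hc₂0 c2 c1
    hll' hl'h' hh'h hmM a4 hdeep₁ hdeep₂ htie htop hmid (by linarith) (by push_cast at hcompP; linarith)
    (by push_cast at hcompN; linarith) ?_
  intro αP1 αP2 αM1 βH βM βG β1 hβH hβM hβG hβ1 hαP1 hαP2 hαM1 hαH hαM hαS hαN hα1'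
  rw [← hmEdef, ← hmCdef]
  exact wide_dual x r c a (gateOf x T₁ j p m) ρe w mE mC (usage x T₂ j l h) (usage x T₂ j l' h') ρS ρN
    (usage x (T₁ + T₂) j (p + l') (p + h')) (usage x (T₁ + T₂) j (p + l') (m + l'))
    (usage x (T₁ + T₂) j (p + l) (p + h)) (usage x (T₁ + T₂) j (m + l) (p + h)) (usage x (T₁ + T₂) j (p + l) (m + l))
    αP1 αP2 αM1 βH βM βG β1
    (p + h ≤ j) (2 * ((m : ℝ) + l) < T₁ + T₂) (T₁ + T₂ < ((p : ℝ) + l') + ((m : ℝ) + l'))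
    (T₁ + T₂ < ((p : ℝ) + l) + ((p : ℝ) + h)) (T₁ + T₂ < ((p : ℝ) + l) + ((m : ℝ) + l))
    hγ hx0 hx1 hr0 hrx hc0 hcx ha0 ha4 hρP1 hρex hρe1 hwe hM1iff hmE hmC hc₁v hc₂v hbal
    hUHl hUHh hcM hUMl hUMh hρS hcS hUS hρN hUNl hUNh hc1 hU1
    hβH hβM hβG hβ1 hαP1 hαP2 hαM1 hαH hαM hαS hαN hα1'

/-- **`LightSliceWide` HOLDS** (census-2 g59's wide residue conjecture, `…QuantLightSliceResidual`), at every floor. [this work] -/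
theorem lightSliceWide_holds : LightSliceWide := by
  intro x T₁ T₂ M₁ M₂ j l₁ h₁ l₁' h₁' l₂ h₂ l₂' h₂' hx0 hx1 hj hd₁ hd₂ ho₁ ho₂ ho₃ ho₄ hw₁ hw₂ hb₁ hb₂ hdeep₁ hdeep₂ hA2 htie htop hlow
    hwide
  obtain ⟨-, hl₁h₁⟩ := hd₁.lt_of
  obtain ⟨-, hl₂h₂⟩ := hd₂.lt_of
  obtain ⟨-, -, -, -, -, -, b2, b3, b4, b5, -, c2, -⟩ := hd₁
  have hwide' : 4 * ((h₁' : ℝ) - l₁') < (h₂' : ℝ) - l₂' := by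
    have h1 : ((4 * (h₁' - l₁') : ℕ) : ℝ) < ((h₂' - l₂' : ℕ) : ℝ) := by exact_mod_cast hwide
    rw [Nat.cast_mul, Nat.cast_sub hl₁h₁.le, Nat.cast_sub hl₂h₂.le] at h1
    exact_mod_cast h1
  exact lightSlice_decAtT_wide x T₁ T₂ M₁ M₂ j l₁' h₁' l₂ h₂ l₂' h₂' hx0 hx1 b2 b3 b4 b5 c2 hd₂ ho₃ ho₄ hdeep₁ (by omega) (by omega)
    htop hlow hwide'

/-- **`LightSliceCore` HOLDS — binder (II) of the R8 law level is a theorem.** [this work] -/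
theorem lightSliceCore_holds : LightSliceCore := lightSliceCore_of_wide lightSliceWide_holds

/-- **`ConvClosedT` HOLDS** (the cone form of convolution closure with the window of layers, lead g22) — via `convClosedT_of_wide`.
[this work] -/
theorem convClosedT_holds : ConvClosedT := convClosedT_of_wide lightSliceWide_holds

end LawDec

/-- **`Quant.FarTreeRow ⟸ GatedConvEmptyFree`.**  CONDITIONAL on (III) only. [this work] -/
theorem farTreeRow_of_gatedConvEmptyFree (hIII : LawDec.GatedConvEmptyFree) : FarTreeRow :=
  farTreeRow_of_wide LawDec.lightSliceWide_holds hIII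

/-- **`Quant.FarTreeRow ⟸ GateMove`.**  CONDITIONAL on (III) only. [this work] -/
theorem farTreeRow_of_gateMove (hG : LawDec.GateMove) : FarTreeRow :=
  farTreeRow_of_wide_gateMove LawDec.lightSliceWide_holds hG

end Quant

end Summit.CriticalPhenomena.PercolationContinuityZ3.Theorems
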